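import Summits.RiemannHypothesis.RiemannHypothesis.Theorems.WeilColumnBSplineFourier
import HarnessLib

/-!
# First-moment Fourier bounds for B-splines: `‖𝓕[y·ρ(y)](ξ)‖` (input of THETA-CERT §D2, the derivative majorant `M₁`)

WEIL column (LADDER-RH, W-P(P2); tier-1 `ThetaCertificateSound`, analytic layer D2, THETA-ASSIGN v1.0 §3). For the B-spline
density `ρ = bsplineDensity c k` (`(k+1)`-fold convolution power of `unif_c`):
* `fourier_const_mul`, `fourier_comp_sub_right` (shift rule), `fourier_mulId_comp_sub` (`𝓕[y·f(y−s)] = e^{−2πisξ}(𝓕[y·f] + s·𝓕f)`);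
* `norm_fourier_mulId_unifDensity_le : ‖𝓕[y·unif_c](ξ)‖ ≤ (1/(2π|ξ|))·(1 + 1/(2πc|ξ|))` (explicit antiderivative `(y/a − 1/a²)e^{ay}`);
* `fourier_mulId_bsplineDensity : 𝓕[y·bspline_{c,k}](ξ) = (k+1)·(𝓕 unif_c ξ)^k · 𝓕[y·unif_c](ξ)` — by the CHAIN RULE on
  `𝓕 bspline = (𝓕 unif)^{k+1}` and Mathlib's `Real.hasDerivAt_fourier` (`(𝓕f)′ = 𝓕[(−2πi y) f]`), no convolution algebra;
* `norm_fourier_mulId_bsplineDensity_le : ‖𝓕[y·bspline_{c,k}](ξ)‖ ≤ (k+1)·(1/(2πc|ξ|))^k·(1/(2π|ξ|))·(1 + 1/(2πc|ξ|))`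
  (= THETA-CERT's `|ρ̂′(ζ)| ≤ (m/|ζ|)^m(1 + m/|ζ|)` in Mathlib's `2π` convention, `c = ε/m`, `k + 1 = m`).
RH-free; nothing here bears on the truth of RH.
-/

set_option linter.dupNamespace false

noncomputable section

open MeasureTheory Set Complex Filter intervalIntegral
open scoped Real FourierTransform
open Literature.NumberTheory.LFunctions

namespace Summit.RiemannHypothesis.RiemannHypothesis.Theorems.WeilColumn.ThetaMellin

/-- `y ↦ y·f(y)` (first moment weight). -/
def mulId (f : ℝ → ℂ) : ℝ → ℂ := fun y => (y : ℂ) * f y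

/-! ## Linear rules for `𝓕` -/

/-- `𝓕(a·f) = a·𝓕f`. [folklore] -/
theorem fourier_const_mul (a : ℂ) (f : ℝ → ℂ) (ξ : ℝ) : 𝓕 (fun y => a * f y) ξ = a * 𝓕 f ξ := by
  rw [Real.fourier_real_eq_integral_exp_smul, Real.fourier_real_eq_integral_exp_smul, ← MeasureTheory.integral_const_mul]
  refine integral_congr_ae (Eventually.of_forall fun v => ?_)
  simp only [smul_eq_mul]
  ring

/-- Shift rule: `𝓕(f(· − s))(ξ) = e^{−2πisξ}·𝓕f(ξ)`. [folklore] -/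
theorem fourier_comp_sub_right (f : ℝ → ℂ) (s ξ : ℝ) :
    𝓕 (fun y => f (y - s)) ξ = Complex.exp (↑(-2 * π * s * ξ) * Complex.I) * 𝓕 f ξ := by
  rw [Real.fourier_real_eq_integral_exp_smul, Real.fourier_real_eq_integral_exp_smul, ← MeasureTheory.integral_const_mul]
  have h := integral_sub_right_eq_self (μ := (volume : Measure ℝ))
    (fun v : ℝ => Complex.exp (↑(-2 * π * (v + s) * ξ) * Complex.I) • f v) s
  simp only [sub_add_cancel] at h
  rw [h]
  refine integral_congr_ae (Eventually.of_forall fun v => ?_)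
  simp only [smul_eq_mul]
  rw [← mul_assoc, ← Complex.exp_add]
  congr 2
  push_cast
  ring

/-- `‖𝓕(f(· − s))(ξ)‖ = ‖𝓕f(ξ)‖`. [folklore] -/
theorem norm_fourier_comp_sub_right (f : ℝ → ℂ) (s ξ : ℝ) : ‖𝓕 (fun y => f (y - s)) ξ‖ = ‖𝓕 f ξ‖ := by
  rw [fourier_comp_sub_right, norm_mul, Complex.norm_exp_ofReal_mul_I, one_mul]

/-- First moment of a shifted function: `𝓕[y·f(y−s)](ξ) = e^{−2πisξ}·(𝓕[y·f](ξ) + s·𝓕f(ξ))`. [folklore] -/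
theorem fourier_mulId_comp_sub {f : ℝ → ℂ} (hf : Integrable f) (hf' : Integrable (mulId f)) (s ξ : ℝ) :
    𝓕 (fun y : ℝ => (y : ℂ) * f (y - s)) ξ =
      Complex.exp (↑(-2 * π * s * ξ) * Complex.I) * (𝓕 (mulId f) ξ + (s : ℂ) * 𝓕 f ξ) := by
  have e : (fun y : ℝ => (y : ℂ) * f (y - s)) = fun y => (fun z : ℝ => mulId f z + (s : ℂ) * f z) (y - s) := by
    funext y
    simp only [mulId]
    push_cast
    ring
  have hi₁ : Integrable fun v : ℝ => Complex.exp (↑(-2 * π * v * ξ) * Complex.I) • mulId f v :=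
    integrable_fourierIntegrand hf' ξ
  have hi₂ : Integrable fun v : ℝ => Complex.exp (↑(-2 * π * v * ξ) * Complex.I) • ((s : ℂ) * f v) :=
    integrable_fourierIntegrand (hf.const_mul _) ξ
  rw [e, fourier_comp_sub_right (fun z : ℝ => mulId f z + (s : ℂ) * f z) s ξ]
  congr 1
  rw [← fourier_const_mul (s : ℂ) f ξ, Real.fourier_real_eq_integral_exp_smul, Real.fourier_real_eq_integral_exp_smul,
    Real.fourier_real_eq_integral_exp_smul, ← integral_add hi₁ hi₂]
  refine integral_congr_ae (Eventually.of_forall fun v => ?_)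
  simp only [smul_eq_mul]
  ring


/-! ## Integrability of the first moment for compactly supported densities -/

/-- `x • f x = mulId f x`. [folklore] -/
theorem smul_eq_mulId (f : ℝ → ℂ) : (fun x : ℝ => x • f x) = mulId f := by
  funext x; simp [mulId, Complex.real_smul]

/-- If `f` is integrable and vanishes off `[−R, R]`, then `y·f(y)` is integrable. [folklore] -/
theorem integrable_mulId_of_support {f : ℝ → ℂ} (hf : Integrable f) {R : ℝ}
    (hsupp : Function.support f ⊆ Icc (-R) R) : Integrable (mulId f) := by
  have e : mulId f = fun x => Set.indicator (Icc (-R) R) (fun y : ℝ => (y : ℂ)) x * f x := by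
    funext x
    simp only [mulId]
    by_cases hx : x ∈ Icc (-R) R
    · rw [indicator_of_mem hx]
    · have : f x = 0 := Function.notMem_support.mp fun h => hx (hsupp h)
      rw [this, mul_zero, mul_zero]
  rw [e]
  refine hf.bdd_mul (c := |R|) ?_ (Eventually.of_forall fun x => ?_)
  · exact (Complex.continuous_ofReal.measurable.indicator measurableSet_Icc).aestronglyMeasurable
  · by_cases hx : x ∈ Icc (-R) R
    · rw [indicator_of_mem hx, Complex.norm_real, Real.norm_eq_abs]
      exact abs_le_abs hx.2 (by linarith [hx.1])
    · rw [indicator_of_notMem hx, norm_zero]; exact abs_nonneg _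

/-- `y·unif_c(y)` is integrable. [folklore] -/
theorem integrable_mulId_unifDensity (c : ℝ) : Integrable (mulId (unifDensity c)) :=
  integrable_mulId_of_support (integrable_unifDensity c) (R := |c|)
    ((support_indicatorConst_subset _ _ _).trans (Icc_subset_Icc (neg_le_neg (le_abs_self c)) (le_abs_self c)))

/-- `y·bspline_{c,k}(y)` is integrable (`c ≥ 0`). [folklore] -/
theorem integrable_mulId_bsplineDensity {c : ℝ} (hc : 0 ≤ c) (k : ℕ) : Integrable (mulId (bsplineDensity c k)) :=
  integrable_mulId_of_support (integrable_bsplineDensity c k) (support_bsplineDensity_subset hc k)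

/-! ## The derivative of `𝓕` is `𝓕` of the first moment -/

/-- `(𝓕f)′(w) = (−2πi)·𝓕[y·f](w)` (Mathlib `Real.hasDerivAt_fourier`). [folklore] -/
theorem hasDerivAt_fourier_mulId {f : ℝ → ℂ} (hf : Integrable f) (hf' : Integrable (mulId f)) (w : ℝ) :
    HasDerivAt (𝓕 f) ((-2 * π * Complex.I) * 𝓕 (mulId f) w) w := by
  have h := Real.hasDerivAt_fourier hf (by rw [smul_eq_mulId]; exact hf') w
  have e : (fun x : ℝ => (-2 * ↑π * Complex.I * ↑x) • f x) = fun x => (-2 * π * Complex.I) * mulId f x := by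
    funext x; simp only [mulId, smul_eq_mul]; ring
  rwa [e, fourier_const_mul] at h

/-- **`𝓕[y·bspline_{c,k}](w) = (k+1)·(𝓕 unif_c w)^k·𝓕[y·unif_c](w)`** — chain rule on `𝓕 bspline = (𝓕 unif)^{k+1}`
and uniqueness of derivatives. [folklore] -/
theorem fourier_mulId_bsplineDensity {c : ℝ} (hc : 0 ≤ c) (k : ℕ) (w : ℝ) :
    𝓕 (mulId (bsplineDensity c k)) w = (k + 1) * (𝓕 (unifDensity c) w) ^ k * 𝓕 (mulId (unifDensity c)) w := by
  have h1 := hasDerivAt_fourier_mulId (integrable_bsplineDensity c k) (integrable_mulId_bsplineDensity hc k) w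
  have hu := hasDerivAt_fourier_mulId (integrable_unifDensity c) (integrable_mulId_unifDensity c) w
  have e : 𝓕 (bsplineDensity c k) = fun w => (𝓕 (unifDensity c) w) ^ (k + 1) := funext (fourier_bsplineDensity c k)
  rw [e] at h1
  have h2 : HasDerivAt (fun w => (𝓕 (unifDensity c) w) ^ (k + 1))
      (((k + 1 : ℕ) : ℂ) * (𝓕 (unifDensity c) w) ^ k * ((-2 * π * Complex.I) * 𝓕 (mulId (unifDensity c)) w)) w :=
    hu.pow (k + 1)
  have huniq := h1.unique h2
  have hK : (-2 * π * Complex.I : ℂ) ≠ 0 := by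
    refine mul_ne_zero (mul_ne_zero (by norm_num) ?_) Complex.I_ne_zero
    exact_mod_cast Real.pi_ne_zero
  have h3 : (-2 * π * Complex.I) * 𝓕 (mulId (bsplineDensity c k)) w =
      (-2 * π * Complex.I) * ((k + 1) * (𝓕 (unifDensity c) w) ^ k * 𝓕 (mulId (unifDensity c)) w) :=
    huniq.trans (by push_cast; ring)
  exact mul_left_cancel₀ hK h3

/-! ## The first moment of the uniform density -/

/-- Antiderivative of `y e^{ay}`: `d/dy[(y/a − 1/a²)e^{ay}] = y e^{ay}` (`a ≠ 0`). [folklore] -/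
theorem hasDerivAt_moment_antideriv {a : ℂ} (ha : a ≠ 0) (y : ℝ) :
    HasDerivAt (fun x : ℝ => ((x : ℂ) / a - 1 / a ^ 2) * Complex.exp (a * x)) ((y : ℂ) * Complex.exp (a * y)) y := by
  have h1 : HasDerivAt (fun x : ℝ => (x : ℂ) / a - 1 / a ^ 2) (1 / a) y := by
    have := ((Complex.ofRealCLM.hasDerivAt (x := y)).div_const a).sub_const (1 / a ^ 2)
    simpa using this
  have h2 : HasDerivAt (fun x : ℝ => Complex.exp (a * x)) (a * Complex.exp (a * y)) y := by
    have : HasDerivAt (fun x : ℝ => a * (x : ℂ)) (a * 1) y := (Complex.ofRealCLM.hasDerivAt (x := y)).const_mul a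
    simpa [mul_comm] using (this.cexp)
  refine (h1.mul h2).congr_deriv ?_
  have : a⁻¹ * a = 1 := inv_mul_cancel₀ ha
  calc 1 / a * Complex.exp (a * y) + ((y : ℂ) / a - 1 / a ^ 2) * (a * Complex.exp (a * y))
      = Complex.exp (a * y) * (a⁻¹ * (1 - (a⁻¹ * a)) + (y : ℂ) * (a⁻¹ * a)) := by ring
    _ = (y : ℂ) * Complex.exp (a * y) := by rw [this]; ring

/-- **`‖𝓕[y·unif_c](ξ)‖ ≤ (1/(2π|ξ|))·(1 + 1/(2πc|ξ|))`** for `c > 0`, `ξ ≠ 0`. [folklore] -/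
theorem norm_fourier_mulId_unifDensity_le {c : ℝ} (hc : 0 < c) {ξ : ℝ} (hξ : ξ ≠ 0) :
    ‖𝓕 (mulId (unifDensity c)) ξ‖ ≤ 1 / (2 * π * |ξ|) * (1 + 1 / (2 * π * c * |ξ|)) := by
  -- reduce to an interval integral
  set a : ℂ := ↑(-2 * π * ξ) * Complex.I with ha
  have ha0 : a ≠ 0 := by
    rw [ha]
    refine mul_ne_zero ?_ Complex.I_ne_zero
    have : (-2 * π * ξ : ℝ) ≠ 0 := by simp [Real.pi_ne_zero, hξ]
    exact_mod_cast this
  have hna : ‖a‖ = 2 * π * |ξ| := by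
    rw [ha, norm_mul, Complex.norm_I, mul_one, Complex.norm_real, Real.norm_eq_abs, abs_mul, abs_mul, abs_neg,
      abs_of_pos Real.pi_pos]; norm_num
  have hF : 𝓕 (mulId (unifDensity c)) ξ = (((2 * c)⁻¹ : ℝ) : ℂ) * ∫ x in (-c)..c, (x : ℂ) * Complex.exp (a * x) := by
    rw [Real.fourier_real_eq_integral_exp_smul]
    have e : (fun v : ℝ => Complex.exp (↑(-2 * π * v * ξ) * Complex.I) • mulId (unifDensity c) v) =
        Set.indicator (Icc (-c) c) (fun v : ℝ => (((2 * c)⁻¹ : ℝ) : ℂ) * ((v : ℂ) * Complex.exp (a * v))) := by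
      funext v
      simp only [mulId, unifDensity, indicatorConst]
      by_cases hv : v ∈ Icc (-c) c
      · rw [indicator_of_mem hv, indicator_of_mem hv, smul_eq_mul, ha]
        have : Complex.exp (↑(-2 * π * v * ξ) * Complex.I) = Complex.exp (↑(-2 * π * ξ) * Complex.I * v) := by
          congr 1; push_cast; ring
        rw [this]; ring
      · rw [indicator_of_notMem hv, indicator_of_notMem hv, mul_zero, smul_zero]
    rw [e, MeasureTheory.integral_indicator measurableSet_Icc, integral_Icc_eq_integral_Ioc,
      ← intervalIntegral.integral_of_le (by linarith), intervalIntegral.integral_const_mul]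
  -- evaluate the interval integral by the antiderivative
  have hint : ∫ x in (-c)..c, (x : ℂ) * Complex.exp (a * x) =
      ((c : ℂ) / a - 1 / a ^ 2) * Complex.exp (a * c) - ((((-c : ℝ) : ℂ)) / a - 1 / a ^ 2) * Complex.exp (a * ((-c : ℝ) : ℂ)) := by
    rw [integral_eq_sub_of_hasDerivAt (fun x _ => hasDerivAt_moment_antideriv ha0 x)
      ((by fun_prop : Continuous fun x : ℝ => (x : ℂ) * Complex.exp (a * x)).intervalIntegrable _ _)]
  -- norms of the boundary terms
  have hexp : ∀ x : ℝ, ‖Complex.exp (a * x)‖ = 1 := fun x => by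
    rw [Complex.norm_exp, ha]; simp
  have hbd : ∀ x : ℝ, |x| = c → ‖((x : ℂ) / a - 1 / a ^ 2) * Complex.exp (a * x)‖ ≤ c / ‖a‖ + 1 / ‖a‖ ^ 2 := by
    intro x hx
    rw [norm_mul, hexp, mul_one]
    refine (norm_sub_le _ _).trans (le_of_eq ?_)
    rw [norm_div, norm_div, norm_pow, Complex.norm_real, Real.norm_eq_abs, hx, norm_one]
  have hpos : 0 < 2 * π * |ξ| := by positivity
  rw [hF, norm_mul, Complex.norm_real, Real.norm_of_nonneg (by positivity), hint]
  have hc' : |(-c : ℝ)| = c := by rw [abs_neg, abs_of_pos hc]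
  calc (2 * c)⁻¹ * ‖((c : ℂ) / a - 1 / a ^ 2) * Complex.exp (a * c) -
          ((((-c : ℝ) : ℂ)) / a - 1 / a ^ 2) * Complex.exp (a * ((-c : ℝ) : ℂ))‖
        ≤ (2 * c)⁻¹ * ((c / ‖a‖ + 1 / ‖a‖ ^ 2) + (c / ‖a‖ + 1 / ‖a‖ ^ 2)) := by
          gcongr
          exact (norm_sub_le _ _).trans (add_le_add (hbd c (abs_of_pos hc)) (hbd (-c) hc'))
    _ = 1 / (2 * π * |ξ|) * (1 + 1 / (2 * π * c * |ξ|)) := by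
          rw [hna]
          field_simp
          ring

/-- **`‖𝓕[y·bspline_{c,k}](ξ)‖ ≤ (k+1)·(1/(2πc|ξ|))^k·(1/(2π|ξ|))·(1 + 1/(2πc|ξ|))`** (`c > 0`, `ξ ≠ 0`). [folklore] -/
theorem norm_fourier_mulId_bsplineDensity_le {c : ℝ} (hc : 0 < c) (k : ℕ) {ξ : ℝ} (hξ : ξ ≠ 0) :
    ‖𝓕 (mulId (bsplineDensity c k)) ξ‖ ≤
      (k + 1) * (1 / (2 * π * c * |ξ|)) ^ k * (1 / (2 * π * |ξ|) * (1 + 1 / (2 * π * c * |ξ|))) := by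
  rw [fourier_mulId_bsplineDensity hc.le k ξ, norm_mul, norm_mul, norm_pow]
  have hk : ‖((k : ℂ) + 1)‖ = (k : ℝ) + 1 := by
    rw [show ((k : ℂ) + 1) = ((k + 1 : ℕ) : ℂ) by push_cast; ring, Complex.norm_natCast]; push_cast; ring
  rw [hk]
  gcongr
  · exact norm_fourier_unifDensity_le hc hξ
  · exact norm_fourier_mulId_unifDensity_le hc hξ

end Summit.RiemannHypothesis.RiemannHypothesis.Theorems.WeilColumn.ThetaMellin
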